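import Summits.QuantumFields.YangMills.Theorems.BalabanUVNodesN19WildMassLetterOfOverAgedCover
import Summits.QuantumFields.YangMills.Theorems.BalabanUVNodesN19TameHellingerLetterRegimeFree
import Summits.QuantumFields.YangMills.Theorems.BalabanUVNodesN20HellingerRoadBoundedCurrent

/-!
# BalabanUVNodes ∕ node N20 (NE7b) — THE COVER-LETTER ROAD END TO END: two over-aged COVERS (one weight system per run, `C₀ = 1`) + radii + ONE tame tilt ⇒ the
# (H) letter; + (R′) + ((R‑c) or a bounded current) ⇒ `HybridNE7` — the refresh-process road with its MODELLING letters discharged by dag-n19-w4 g8's cover letters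

Cell `pub-ymgap` (HUMAN RULING D-0062 Track A ∕ director-ym R399 (3a) second-wave width seats), WIDTH SEAT `pub-ymgap-dag-n20-w5` (node n20 = NE7b),
generation g5, CLAIM-4 ∕ INTENT-4 (bus 2026-08-28T12:16Z; the composition handed over by dag-n19-w4 g8, I.37093 ∕ I.37435).  Key item K3⁸ `SpineGivenEndpointR13SepCoPHV`
(stmt-QuantumFields-27366; skeleton of record v6 b4e55110ab73e679, stub `stub_expansion13HV`) — K3⁷ stmt-QuantumFields-20544 aside; filed
`--kind proof --supports … --as helper`.  COUNT-NEUTRAL.  THEOREMS ONLY (0 `def`, 0 `instance`, 0 `notation`, 0 `sorry`).  ADDITIVE — imports dag-n19-w4 g8's p631835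
`…N19WildMassLetterOfOverAgedCover` (`classWildMass_summable_of_coverLetters`) and p627322 `…N19TameHellingerLetterRegimeFree` (`affinityDefectLetter_of_tameTilt`), and this
seat's p626582 `…N20HellingerRoadBoundedCurrent` (⊇ p623765 `exists_hybridNE7_of_affinityDefectLetter_and_response`, p621610 `wildMass_summable_pair`) BY NAME; nothing of
theirs restated; modifies nothing.
v1.1 (generation g6, CLAIM-1, APPEND-ONLY; the three landed declarations of p637046 byte-identical): ADDS §1's advertised corollary ★ `hellingerRate_of_coverLetters_and_tameTilt`
(the ρ-shape `∃ ρ ≥ 0, Σ ρ_K < ∞, √(1 − 𝒜_K(t)) ≤ ρ_K`, dag-n19-w4's `exists_summable_sqrt_rate` BY NAME) — referee ref-Q g3 READ-97 noted the header bullet without its theorem.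

WHY.  This seat's p629153 (`…N20RefreshProcessRoadRegimeFree`) runs the hellinger road from two abstract refresh processes whose link to the class weights is ONE MODELLING
letter per run (`hmodel`: relative wild mass `≤ C₀ ×` the over-age pattern sums).  dag-n19-w4 g7∕g8 (p623281, p631835) DERIVED that letter, with `C₀ = 1`, from four
structural letters on ONE down-closed weight system per run — the deficit factorisation (KR‑dc), the pendency containment (PEND), the positions count (POS) and the COVER
«every wild class is over-aged at some birth datum» — producing EXACTLY the `(wm, hwm, hwild, hws)` block of the road's K-summation.  THIS FILE is the composition: cover
letters for run A and for run B (each with ITS OWN scalars, event sets, position types and over-age predicates) + radii + ONE bound + ONE tilt branch ⇒ (H); then the two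
capstones.  After it the V-side of the road displays NO modelling letter and NO density constant.
* §1 ★★★ `affinityDefectLetter_of_coverLetters_and_tameTilt` — carriers `T K : Finset (Finset α)` DOWN-CLOSED, class weights `A, B` nonnegative on `T K` and positive on
  the window `|t| ≤ l₀`, wild sets `W K t ⊆ T K`; for EACH run p631835's cover letters VERBATIM (factors `0 ≤ w ≤ e^{−P}`, rate `θ·ℓ ≤ P∕2`, entropy `Σ e^{−P∕2} ≤ Z₀ + ζm`,
  scalars `θ ≥ 0`, `Λ + ζ < θ`, `κ₁(θ−Λ−ζ) > 2`, budget `b`; (KR‑dc) `hfac`; (POS) `hpos`; (PEND) `hpend`; depth bound `M`; COVER `hcover`) + radii `Σ 1∕r_K < ∞` + ONE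
  bound `𝔅` + ONE tilt branch per `(K,t)` ⇒ the (H) letter `∃ η ≥ 0, Σ√η_K < ∞, 1 − 𝒜_K(t) ≤ η_K`.  ★ `hellingerRate_of_coverLetters_and_tameTilt` (ρ-shape).
* §2 ★★★ `exists_hybridNE7_of_coverLetters_tameTilt_and_response` — + E1∕E2, differentiable weights, (R′), (R‑c) ⇒ `∃ η Wsh shA shB, (H) ∧ Σ√η<∞ ∧ budget bounds ∧
  HybridNE7 l₀ vol T A B ∅ 0 shA shB Wsh (K ↦ l₀(R₁ K + 2√(2η_K)√χ)∕vol)` (p623765 BY NAME) · ★★ `exists_hybridNE7_of_coverLetters_tameTilt_and_boundedCurrent` — (R‑c)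
  replaced by `|A'| ≤ M·A` (p626582 BY NAME).
READING (located, nothing proposed).  (i) The end-to-end letter list of the cover road: per run (KR‑dc) + (PEND) + (POS) + COVER + factor ∕ price ∕ rate ∕ entropy letters
(ONE weight system, `C₀ = 1`) — then radii ((V‑b) = (YG)) + ONE tilt branch + `𝔅` ((KR)) — then (R′) + ((R‑c) or bounded current); at the keyed gas the R-side reduces
further to per-polymer letters (this seat's p630823 ∕ p632414).  (ii) (KR‑dc) becomes TYPABLE against the datum once a skeleton exposes keyed carriers at the window key
(plan's `kr := wkey`, idea-3's trigger (T2)) — nothing here types it.  (iii) Nonnegativity of the weights is asked at every `t` (p631835's socket), positivity on the window.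

HONEST FRAMING.  [folklore] by-name composition of three LANDED files on hypothesis SHAPES; EVERY letter — cover letters ((KR‑dc), (PEND), (POS), COVER = idea-3 g13's
READING of [LF‑II] (1.79)–(1.85), located A∧B by CRIT-1 g6), p621610's process letters, radii ((V‑b)=(YG), two-run, UNPRINTED for d = 4), the tilt branch ((KR)), (R′)
(two-run, UNPRINTED), (R‑c) ∕ bounded current — is a HYPOTHESIS produced by nobody; NO estimate of Bałaban's programme is proved; nothing of Bałaban's asserted or
instantiated (no `Provisos₁₃SepCoPH` tuple — K0⁷ OPEN); NE7 ∕ NE7b ∕ NE7c NOT PRINTED as two-run statements for d = 4 and NOT proved; N19′ ∕ N20 ∕ N21 NOT discharged; K3⁸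
OPEN (v6 STANDS), K3⁷ aside, neither claimed; no summit statement is proved by this seat; counts UNMOVED (typed 28∕28 · discharged 5∕28; 5∕27 excl. NODE O).  One finite
four-torus programme at fixed ε — NOT ℝ⁴, NOT infinite volume, NOT OS, NOT a mass gap, NOT the Clay problem (R4 closes the conditional finite-𝕋⁴ rung `BalabanLadder.UV`
only).  0 `def`; 0 `sorry`; standard axioms; no cite tags.
-/

noncomputable section

namespace Summit.QuantumFields.YangMills.BalabanUVNodes.N20CoverLetterRoad

open Finset
open Literature.MathematicalPhysics.QuantumFieldTheory.Balaban1983to89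
open T4MatchingAssembly (HybridNE7)
open Summit.QuantumFields.YangMills.BalabanUVNodes.N20OverAgeRefreshProcess (wildMass_summable_pair)
open Summit.QuantumFields.YangMills.BalabanUVNodes.N19WildMassLetterOfOverAgedCover (classWildMass_summable_of_coverLetters)
open Summit.QuantumFields.YangMills.BalabanUVNodes.N19TameConditionedHellingerLetterAlongK (exists_summable_sqrt_rate)
open Summit.QuantumFields.YangMills.BalabanUVNodes.N19TameHellingerLetterRegimeFree (affinityDefectLetter_of_tameTilt)
open Summit.QuantumFields.YangMills.BalabanUVNodes.N20HellingerRoadCapstone (exists_hybridNE7_of_affinityDefectLetter_and_response)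
open Summit.QuantumFields.YangMills.BalabanUVNodes.N20HellingerRoadBoundedCurrent (exists_hybridNE7_of_affinityDefectLetter_response_boundedCurrent)

variable {α : Type*} [DecidableEq α] {πA πB : Type*}

/-! ## §1 The (H) letter from two over-aged covers, the radii and ONE tame tilt branch [folklore + by-name] -/
section Letter
variable {l₀ : ℝ}

/-- **★★★ THE (H) LETTER FROM TWO COVER-LETTER SYSTEMS AND ONE TAME TILT** [folklore; junction BY NAME of p631835 `classWildMass_summable_of_coverLetters` (×2, per-run
scalars, position types and over-age predicates), p621610 `wildMass_summable_pair` and p627322 `affinityDefectLetter_of_tameTilt`].  Carriers: DOWN-CLOSED class families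
`T K : Finset (Finset α)` (histories as refresh-event sets), class weights `A, B : ℕ → ℝ → Finset α → ℝ` nonnegative on `T K` and positive on the window `|t| ≤ l₀`, wild
sets `W K t ⊆ T K`.  For EACH run: refresh-event sets `U`, factors `0 ≤ w ≤ e^{−P}`, epoch lengths with `θ·ℓ ≤ P∕2`, entropy `Σ_U e^{−P∕2} ≤ Z₀ + ζm`, scalars `θ ≥ 0`,
`Λ + ζ < θ`, `κ₁(θ − Λ − ζ) > 2`, budget `b`; the deficit factorisation (KR‑dc); positions `Pos m` with `|Pos m| ≤ e^{Λm}` ((POS)); the pendency containment (PEND); a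
depth bound `M K` and the COVER «every wild class is over-aged at some datum `(m,p)` with `b + κ₁ log K ≤ m < M K`».  Plus radii `r_K > 0`, `Σ 1∕r_K < ∞` ((V‑b) =
(YG)), ONE bound `𝔅 ≥ 0`, ONE branch per `(K,t)` of `log(Σ_{T∖W} A e^{z(log B − log A)} ∕ Σ_{T∖W} A)` on `closedBall 0 r_K` bounded by `𝔅` ((KR)).  Conclusion: the
(H) letter `∃ η ≥ 0, Σ_K √η_K < ∞, 1 − Σ_{T K} √(p_{A,K,t} p_{B,K,t}) ≤ η_K` on the window.  NO modelling letter, NO density constant, NO regime. -/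
theorem affinityDefectLetter_of_coverLetters_and_tameTilt (T : ℕ → Finset (Finset α)) (A B : ℕ → ℝ → Finset α → ℝ)
    (hA0 : ∀ K t, ∀ X ∈ T K, 0 ≤ A K t X) (hB0 : ∀ K t, ∀ X ∈ T K, 0 ≤ B K t X)
    (hA : ∀ K t, |t| ≤ l₀ → ∀ X ∈ T K, 0 < A K t X) (hB : ∀ K t, |t| ≤ l₀ → ∀ X ∈ T K, 0 < B K t X)
    (hdown : ∀ K, ∀ X ∈ T K, ∀ Y, Y ⊆ X → Y ∈ T K)
    (W : ℕ → ℝ → Finset (Finset α)) (hW : ∀ K t, W K t ⊆ T K)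
    -- run A's cover letters (p631835's socket, verbatim)
    {θA ΛA ζA κA ZA : ℝ} (bA : ℝ) (hθA : 0 ≤ θA) (hΛθA : ΛA + ζA < θA) (hκA : 2 < κA * (θA - ΛA - ζA))
    (UA : ℕ → ℝ → ℕ → Finset α) (wA ℓA PA : ℕ → ℝ → ℕ → α → ℝ)
    (hwA0 : ∀ K t m j, 0 ≤ wA K t m j)
    (hwA : ∀ K t m, ∀ j ∈ UA K t m, wA K t m j ≤ Real.exp (-PA K t m j))
    (hθPA : ∀ K t m, ∀ j ∈ UA K t m, θA * ℓA K t m j ≤ PA K t m j / 2)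
    (hZA : ∀ K t (m : ℕ), ∑ j ∈ UA K t m, Real.exp (-(PA K t m j / 2)) ≤ ZA + ζA * m)
    (hfacA : ∀ K t m, ∀ X ∈ T K, ∀ S, S ⊆ X → A K t X ≤ (∏ j ∈ S, wA K t m j) * A K t (X \ S))
    (PosA : ℕ → ℕ → Finset πA) (hposA : ∀ K m, ((PosA K m).card : ℝ) ≤ Real.exp (ΛA * m))
    (OverA : ℕ → ℝ → ℕ → πA → Finset α → Prop) [∀ K t m p, DecidablePred (OverA K t m p)]
    (hpendA : ∀ K t m p, ∀ X ∈ T K, OverA K t m p X → ∃ S, S ⊆ UA K t m ∧ ((m : ℝ) - bA ≤ ∑ j ∈ S, ℓA K t m j) ∧ S ⊆ X)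
    (MA : ℕ → ℕ)
    (hcoverA : ∀ (K : ℕ) (t : ℝ), |t| ≤ l₀ → 1 ≤ K → ∀ X ∈ W K t,
      ∃ m ∈ range (MA K), bA + κA * Real.log (K : ℝ) ≤ (m : ℝ) ∧ ∃ p ∈ PosA K m, OverA K t m p X)
    -- run B's cover letters
    {θB ΛB ζB κB ZB : ℝ} (bB : ℝ) (hθB : 0 ≤ θB) (hΛθB : ΛB + ζB < θB) (hκB : 2 < κB * (θB - ΛB - ζB))
    (UB : ℕ → ℝ → ℕ → Finset α) (wB ℓB PB : ℕ → ℝ → ℕ → α → ℝ)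
    (hwB0 : ∀ K t m j, 0 ≤ wB K t m j)
    (hwB : ∀ K t m, ∀ j ∈ UB K t m, wB K t m j ≤ Real.exp (-PB K t m j))
    (hθPB : ∀ K t m, ∀ j ∈ UB K t m, θB * ℓB K t m j ≤ PB K t m j / 2)
    (hZB : ∀ K t (m : ℕ), ∑ j ∈ UB K t m, Real.exp (-(PB K t m j / 2)) ≤ ZB + ζB * m)
    (hfacB : ∀ K t m, ∀ X ∈ T K, ∀ S, S ⊆ X → B K t X ≤ (∏ j ∈ S, wB K t m j) * B K t (X \ S))
    (PosB : ℕ → ℕ → Finset πB) (hposB : ∀ K m, ((PosB K m).card : ℝ) ≤ Real.exp (ΛB * m))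
    (OverB : ℕ → ℝ → ℕ → πB → Finset α → Prop) [∀ K t m p, DecidablePred (OverB K t m p)]
    (hpendB : ∀ K t m p, ∀ X ∈ T K, OverB K t m p X → ∃ S, S ⊆ UB K t m ∧ ((m : ℝ) - bB ≤ ∑ j ∈ S, ℓB K t m j) ∧ S ⊆ X)
    (MB : ℕ → ℕ)
    (hcoverB : ∀ (K : ℕ) (t : ℝ), |t| ≤ l₀ → 1 ≤ K → ∀ X ∈ W K t,
      ∃ m ∈ range (MB K), bB + κB * Real.log (K : ℝ) ≤ (m : ℝ) ∧ ∃ p ∈ PosB K m, OverB K t m p X)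
    -- radii, ONE bound, ONE tilt branch (p627322)
    (r : ℕ → ℝ) (hr : ∀ K, 0 < r K) (hrs : Summable fun K => 1 / r K)
    {𝔅 : ℝ} (h𝔅 : 0 ≤ 𝔅)
    (htilt : ∀ K t, |t| ≤ l₀ → ∃ φ : ℂ → ℂ,
      DifferentiableOn ℂ φ (Metric.closedBall 0 (r K)) ∧
      (∀ s ∈ Metric.closedBall (0:ℂ) (r K), Complex.exp (φ s)
        = (∑ τ ∈ T K \ W K t, (A K t τ : ℂ) * Complex.exp (s * ((Real.log (B K t τ) - Real.log (A K t τ) : ℝ) : ℂ)))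
            / ∑ τ ∈ T K \ W K t, (A K t τ : ℂ)) ∧
      (∀ s ∈ Metric.closedBall (0:ℂ) (r K), ‖φ s‖ ≤ 𝔅)) :
    ∃ η : ℕ → ℝ, (∀ K, 0 ≤ η K) ∧ Summable (fun K => Real.sqrt (η K)) ∧
      ∀ K t, |t| ≤ l₀ →
        1 - ∑ τ ∈ T K, Real.sqrt ((A K t τ / ∑ σ ∈ T K, A K t σ) * (B K t τ / ∑ σ ∈ T K, B K t σ)) ≤ η K := by
  obtain ⟨wm, hwm, hws, hwildA, hwildB⟩ := wildMass_summable_pair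
    (classWildMass_summable_of_coverLetters T A hA0 hdown W hW bA hθA hΛθA hκA UA wA ℓA PA hwA0 hwA hθPA hZA hfacA PosA hposA
      OverA hpendA MA hcoverA)
    (classWildMass_summable_of_coverLetters T B hB0 hdown W hW bB hθB hΛθB hκB UB wB ℓB PB hwB0 hwB hθPB hZB hfacB PosB hposB
      OverB hpendB MB hcoverB)
  exact affinityDefectLetter_of_tameTilt T A B hA hB W hW wm hwm hwildA hwildB hws r hr hrs h𝔅 htilt

/-- **★ COROLLARY — THE SUMMABLE HELLINGER RATE FROM TWO COVERS AND ONE TAME TILT** [folklore; v1.1].  Under the hypotheses of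
`affinityDefectLetter_of_coverLetters_and_tameTilt` there is a SUMMABLE `ρ ≥ 0` with `√(1 − Σ_{T K} √(p_{A,K,t}·p_{B,K,t})) ≤ ρ_K` for every `K` and `|t| ≤ l₀` — the
ρ-shape of the (H) letter (idea-3 ed.3's `hellingerRate_of_tilts`; this seat's p622199 ∕ p629153 editions for refresh processes), here for the cover road:
§1 then dag-n19-w4's `exists_summable_sqrt_rate` BY NAME.  Every letter is a HYPOTHESIS; nothing of the programme is proved. -/
theorem hellingerRate_of_coverLetters_and_tameTilt (T : ℕ → Finset (Finset α)) (A B : ℕ → ℝ → Finset α → ℝ)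
    (hA0 : ∀ K t, ∀ X ∈ T K, 0 ≤ A K t X) (hB0 : ∀ K t, ∀ X ∈ T K, 0 ≤ B K t X)
    (hA : ∀ K t, |t| ≤ l₀ → ∀ X ∈ T K, 0 < A K t X) (hB : ∀ K t, |t| ≤ l₀ → ∀ X ∈ T K, 0 < B K t X)
    (hdown : ∀ K, ∀ X ∈ T K, ∀ Y, Y ⊆ X → Y ∈ T K)
    (W : ℕ → ℝ → Finset (Finset α)) (hW : ∀ K t, W K t ⊆ T K)
    -- run A's cover letters (p631835's socket, verbatim)
    {θA ΛA ζA κA ZA : ℝ} (bA : ℝ) (hθA : 0 ≤ θA) (hΛθA : ΛA + ζA < θA) (hκA : 2 < κA * (θA - ΛA - ζA))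
    (UA : ℕ → ℝ → ℕ → Finset α) (wA ℓA PA : ℕ → ℝ → ℕ → α → ℝ)
    (hwA0 : ∀ K t m j, 0 ≤ wA K t m j)
    (hwA : ∀ K t m, ∀ j ∈ UA K t m, wA K t m j ≤ Real.exp (-PA K t m j))
    (hθPA : ∀ K t m, ∀ j ∈ UA K t m, θA * ℓA K t m j ≤ PA K t m j / 2)
    (hZA : ∀ K t (m : ℕ), ∑ j ∈ UA K t m, Real.exp (-(PA K t m j / 2)) ≤ ZA + ζA * m)
    (hfacA : ∀ K t m, ∀ X ∈ T K, ∀ S, S ⊆ X → A K t X ≤ (∏ j ∈ S, wA K t m j) * A K t (X \ S))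
    (PosA : ℕ → ℕ → Finset πA) (hposA : ∀ K m, ((PosA K m).card : ℝ) ≤ Real.exp (ΛA * m))
    (OverA : ℕ → ℝ → ℕ → πA → Finset α → Prop) [∀ K t m p, DecidablePred (OverA K t m p)]
    (hpendA : ∀ K t m p, ∀ X ∈ T K, OverA K t m p X → ∃ S, S ⊆ UA K t m ∧ ((m : ℝ) - bA ≤ ∑ j ∈ S, ℓA K t m j) ∧ S ⊆ X)
    (MA : ℕ → ℕ)
    (hcoverA : ∀ (K : ℕ) (t : ℝ), |t| ≤ l₀ → 1 ≤ K → ∀ X ∈ W K t,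
      ∃ m ∈ range (MA K), bA + κA * Real.log (K : ℝ) ≤ (m : ℝ) ∧ ∃ p ∈ PosA K m, OverA K t m p X)
    -- run B's cover letters
    {θB ΛB ζB κB ZB : ℝ} (bB : ℝ) (hθB : 0 ≤ θB) (hΛθB : ΛB + ζB < θB) (hκB : 2 < κB * (θB - ΛB - ζB))
    (UB : ℕ → ℝ → ℕ → Finset α) (wB ℓB PB : ℕ → ℝ → ℕ → α → ℝ)
    (hwB0 : ∀ K t m j, 0 ≤ wB K t m j)
    (hwB : ∀ K t m, ∀ j ∈ UB K t m, wB K t m j ≤ Real.exp (-PB K t m j))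
    (hθPB : ∀ K t m, ∀ j ∈ UB K t m, θB * ℓB K t m j ≤ PB K t m j / 2)
    (hZB : ∀ K t (m : ℕ), ∑ j ∈ UB K t m, Real.exp (-(PB K t m j / 2)) ≤ ZB + ζB * m)
    (hfacB : ∀ K t m, ∀ X ∈ T K, ∀ S, S ⊆ X → B K t X ≤ (∏ j ∈ S, wB K t m j) * B K t (X \ S))
    (PosB : ℕ → ℕ → Finset πB) (hposB : ∀ K m, ((PosB K m).card : ℝ) ≤ Real.exp (ΛB * m))
    (OverB : ℕ → ℝ → ℕ → πB → Finset α → Prop) [∀ K t m p, DecidablePred (OverB K t m p)]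
    (hpendB : ∀ K t m p, ∀ X ∈ T K, OverB K t m p X → ∃ S, S ⊆ UB K t m ∧ ((m : ℝ) - bB ≤ ∑ j ∈ S, ℓB K t m j) ∧ S ⊆ X)
    (MB : ℕ → ℕ)
    (hcoverB : ∀ (K : ℕ) (t : ℝ), |t| ≤ l₀ → 1 ≤ K → ∀ X ∈ W K t,
      ∃ m ∈ range (MB K), bB + κB * Real.log (K : ℝ) ≤ (m : ℝ) ∧ ∃ p ∈ PosB K m, OverB K t m p X)
    -- radii, ONE bound, ONE tilt branch (p627322)
    (r : ℕ → ℝ) (hr : ∀ K, 0 < r K) (hrs : Summable fun K => 1 / r K)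
    {𝔅 : ℝ} (h𝔅 : 0 ≤ 𝔅)
    (htilt : ∀ K t, |t| ≤ l₀ → ∃ φ : ℂ → ℂ,
      DifferentiableOn ℂ φ (Metric.closedBall 0 (r K)) ∧
      (∀ s ∈ Metric.closedBall (0:ℂ) (r K), Complex.exp (φ s)
        = (∑ τ ∈ T K \ W K t, (A K t τ : ℂ) * Complex.exp (s * ((Real.log (B K t τ) - Real.log (A K t τ) : ℝ) : ℂ)))
            / ∑ τ ∈ T K \ W K t, (A K t τ : ℂ)) ∧
      (∀ s ∈ Metric.closedBall (0:ℂ) (r K), ‖φ s‖ ≤ 𝔅)) :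
    ∃ ρ : ℕ → ℝ, Summable ρ ∧ (∀ K, 0 ≤ ρ K) ∧ ∀ K t, |t| ≤ l₀ →
      Real.sqrt (1 - ∑ τ ∈ T K, Real.sqrt ((A K t τ / ∑ σ ∈ T K, A K t σ) * (B K t τ / ∑ σ ∈ T K, B K t σ))) ≤ ρ K := by
  obtain ⟨η, _, hs, hη⟩ := affinityDefectLetter_of_coverLetters_and_tameTilt T A B hA0 hB0 hA hB hdown W hW bA hθA hΛθA hκA UA wA ℓA PA
    hwA0 hwA hθPA hZA hfacA PosA hposA OverA hpendA MA hcoverA bB hθB hΛθB hκB UB wB ℓB PB hwB0 hwB hθPB hZB hfacB PosB hposB OverB hpendB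
    MB hcoverB r hr hrs h𝔅 htilt
  exact exists_summable_sqrt_rate hs hη

end Letter

/-! ## §2 The capstones: cover letters + ONE tame tilt + the R-side ⇒ `HybridNE7` [by-name through p623765 ∕ p626582] -/
section Capstone
variable {l₀ vol : ℝ}

/-- **★★★ `HybridNE7` FROM TWO COVER-LETTER SYSTEMS, ONE TAME TILT AND THE ENDPOINT RESPONSE** [folklore + by-name: p623765
`exists_hybridNE7_of_affinityDefectLetter_and_response` fed with §1].  §1's letters + positive totals, the E1∕E2 dictionary, class weights DIFFERENTIABLE in the source
with derivative carriers `A', B'`, (R′) `|E_{q_{K,s}}[B'∕B − A'∕A]| ≤ R₁ K` with `Σ R₁ < ∞`, (R‑c) `Σ ½(p+q)(A'∕A − m)² ≤ χ` ⇒ `∃ η Wsh shA shB` with (H), `Σ√η < ∞`,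
`0 ≤ Wsh ≤ √(2η)`, `Wsh < 1`, and `HybridNE7 l₀ vol T A B (fun _ _ => ∅) (fun _ => 0) shA shB Wsh (K ↦ l₀·(R₁ K + 2√(2η_K)√χ)∕vol)`. -/
theorem exists_hybridNE7_of_coverLetters_tameTilt_and_response (hl₀ : 0 ≤ l₀) (hvol : 0 < vol)
    (T : ℕ → Finset (Finset α)) (A B : ℕ → ℝ → Finset α → ℝ)
    (hA0 : ∀ K t, ∀ X ∈ T K, 0 ≤ A K t X) (hB0 : ∀ K t, ∀ X ∈ T K, 0 ≤ B K t X)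
    (hA : ∀ (K : ℕ) (t : ℝ), |t| ≤ l₀ → ∀ X ∈ T K, 0 < A K t X) (hB : ∀ (K : ℕ) (t : ℝ), |t| ≤ l₀ → ∀ X ∈ T K, 0 < B K t X)
    (hZA : ∀ (K : ℕ) (t : ℝ), |t| ≤ l₀ → 0 < ∑ τ ∈ T K, A K t τ) (hZB : ∀ (K : ℕ) (t : ℝ), |t| ≤ l₀ → 0 < ∑ τ ∈ T K, B K t τ)
    {Z : ℕ → ℝ → ℝ} (hZA' : ∀ (K : ℕ) (t : ℝ), |t| ≤ l₀ → Z K t = ∑ τ ∈ T K, A K t τ)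
    (hZB' : ∀ (K : ℕ) (t : ℝ), |t| ≤ l₀ → Z (K + 1) t = ∑ τ ∈ T K, B K t τ)
    {A' B' : ℕ → ℝ → Finset α → ℝ}
    (hdA : ∀ (K : ℕ) (s : ℝ), |s| ≤ l₀ → ∀ τ ∈ T K, HasDerivAt (fun u => A K u τ) (A' K s τ) s)
    (hdB : ∀ (K : ℕ) (s : ℝ), |s| ≤ l₀ → ∀ τ ∈ T K, HasDerivAt (fun u => B K u τ) (B' K s τ) s)
    (hdown : ∀ K, ∀ X ∈ T K, ∀ Y, Y ⊆ X → Y ∈ T K)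
    (W : ℕ → ℝ → Finset (Finset α)) (hW : ∀ K t, W K t ⊆ T K)
    {θA ΛA ζA κA ZA : ℝ} (bA : ℝ) (hθA : 0 ≤ θA) (hΛθA : ΛA + ζA < θA) (hκA : 2 < κA * (θA - ΛA - ζA))
    (UA : ℕ → ℝ → ℕ → Finset α) (wA ℓA PA : ℕ → ℝ → ℕ → α → ℝ)
    (hwA0 : ∀ K t m j, 0 ≤ wA K t m j)
    (hwA : ∀ K t m, ∀ j ∈ UA K t m, wA K t m j ≤ Real.exp (-PA K t m j))
    (hθPA : ∀ K t m, ∀ j ∈ UA K t m, θA * ℓA K t m j ≤ PA K t m j / 2)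
    (hZ0A : ∀ K t (m : ℕ), ∑ j ∈ UA K t m, Real.exp (-(PA K t m j / 2)) ≤ ZA + ζA * m)
    (hfacA : ∀ K t m, ∀ X ∈ T K, ∀ S, S ⊆ X → A K t X ≤ (∏ j ∈ S, wA K t m j) * A K t (X \ S))
    (PosA : ℕ → ℕ → Finset πA) (hposA : ∀ K m, ((PosA K m).card : ℝ) ≤ Real.exp (ΛA * m))
    (OverA : ℕ → ℝ → ℕ → πA → Finset α → Prop) [∀ K t m p, DecidablePred (OverA K t m p)]
    (hpendA : ∀ K t m p, ∀ X ∈ T K, OverA K t m p X → ∃ S, S ⊆ UA K t m ∧ ((m : ℝ) - bA ≤ ∑ j ∈ S, ℓA K t m j) ∧ S ⊆ X)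
    (MA : ℕ → ℕ)
    (hcoverA : ∀ (K : ℕ) (t : ℝ), |t| ≤ l₀ → 1 ≤ K → ∀ X ∈ W K t,
      ∃ m ∈ range (MA K), bA + κA * Real.log (K : ℝ) ≤ (m : ℝ) ∧ ∃ p ∈ PosA K m, OverA K t m p X)
    {θB ΛB ζB κB ZB : ℝ} (bB : ℝ) (hθB : 0 ≤ θB) (hΛθB : ΛB + ζB < θB) (hκB : 2 < κB * (θB - ΛB - ζB))
    (UB : ℕ → ℝ → ℕ → Finset α) (wB ℓB PB : ℕ → ℝ → ℕ → α → ℝ)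
    (hwB0 : ∀ K t m j, 0 ≤ wB K t m j)
    (hwB : ∀ K t m, ∀ j ∈ UB K t m, wB K t m j ≤ Real.exp (-PB K t m j))
    (hθPB : ∀ K t m, ∀ j ∈ UB K t m, θB * ℓB K t m j ≤ PB K t m j / 2)
    (hZ0B : ∀ K t (m : ℕ), ∑ j ∈ UB K t m, Real.exp (-(PB K t m j / 2)) ≤ ZB + ζB * m)
    (hfacB : ∀ K t m, ∀ X ∈ T K, ∀ S, S ⊆ X → B K t X ≤ (∏ j ∈ S, wB K t m j) * B K t (X \ S))
    (PosB : ℕ → ℕ → Finset πB) (hposB : ∀ K m, ((PosB K m).card : ℝ) ≤ Real.exp (ΛB * m))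
    (OverB : ℕ → ℝ → ℕ → πB → Finset α → Prop) [∀ K t m p, DecidablePred (OverB K t m p)]
    (hpendB : ∀ K t m p, ∀ X ∈ T K, OverB K t m p X → ∃ S, S ⊆ UB K t m ∧ ((m : ℝ) - bB ≤ ∑ j ∈ S, ℓB K t m j) ∧ S ⊆ X)
    (MB : ℕ → ℕ)
    (hcoverB : ∀ (K : ℕ) (t : ℝ), |t| ≤ l₀ → 1 ≤ K → ∀ X ∈ W K t,
      ∃ m ∈ range (MB K), bB + κB * Real.log (K : ℝ) ≤ (m : ℝ) ∧ ∃ p ∈ PosB K m, OverB K t m p X)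
    (r : ℕ → ℝ) (hr : ∀ K, 0 < r K) (hrs : Summable fun K => 1 / r K)
    {𝔅 : ℝ} (h𝔅 : 0 ≤ 𝔅)
    (htilt : ∀ K t, |t| ≤ l₀ → ∃ φ : ℂ → ℂ,
      DifferentiableOn ℂ φ (Metric.closedBall 0 (r K)) ∧
      (∀ s ∈ Metric.closedBall (0:ℂ) (r K), Complex.exp (φ s)
        = (∑ τ ∈ T K \ W K t, (A K t τ : ℂ) * Complex.exp (s * ((Real.log (B K t τ) - Real.log (A K t τ) : ℝ) : ℂ)))
            / ∑ τ ∈ T K \ W K t, (A K t τ : ℂ)) ∧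
      (∀ s ∈ Metric.closedBall (0:ℂ) (r K), ‖φ s‖ ≤ 𝔅))
    {R₁ : ℕ → ℝ} {χ : ℝ} {m : ℕ → ℝ → ℝ}
    (hR : ∀ (K : ℕ) (s : ℝ), |s| ≤ l₀ →
      |∑ τ ∈ T K, B K s τ / (∑ σ ∈ T K, B K s σ) * (B' K s τ / B K s τ - A' K s τ / A K s τ)| ≤ R₁ K)
    (hRs : Summable R₁)
    (hχ : ∀ (K : ℕ) (s : ℝ), |s| ≤ l₀ →
      ∑ τ ∈ T K, (A K s τ / (∑ σ ∈ T K, A K s σ) + B K s τ / (∑ σ ∈ T K, B K s σ)) / 2 * (A' K s τ / A K s τ - m K s) ^ 2 ≤ χ) :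
    ∃ (η Wsh : ℕ → ℝ) (shA shB : ℕ → ℝ → Finset α → ℝ),
      (∀ (K : ℕ) (t : ℝ), |t| ≤ l₀ →
        1 - ∑ τ ∈ T K, Real.sqrt ((A K t τ / ∑ σ ∈ T K, A K t σ) * (B K t τ / ∑ σ ∈ T K, B K t σ)) ≤ η K) ∧
      Summable (fun K => Real.sqrt (η K)) ∧
      (∀ K, 0 ≤ Wsh K ∧ Wsh K ≤ Real.sqrt (2 * η K) ∧ Wsh K < 1) ∧
      HybridNE7 l₀ vol T A B (fun _ _ => ∅) (fun _ => 0) shA shB Wsh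
        (fun K => l₀ * (R₁ K + 2 * Real.sqrt (2 * η K) * Real.sqrt χ) / vol) :=
  exists_hybridNE7_of_affinityDefectLetter_and_response hl₀ hvol hA hB hZA hZB hZA' hZB' hdA hdB
    (affinityDefectLetter_of_coverLetters_and_tameTilt T A B hA0 hB0 hA hB hdown W hW bA hθA hΛθA hκA UA wA ℓA PA hwA0 hwA hθPA hZ0A hfacA
      PosA hposA OverA hpendA MA hcoverA bB hθB hΛθB hκB UB wB ℓB PB hwB0 hwB hθPB hZ0B hfacB PosB hposB OverB hpendB MB hcoverB r hr hrs h𝔅 htilt)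
    hR hRs hχ

/-- **★★ THE SAME WITH A BOUNDED SOURCE CURRENT** [folklore + by-name: p626582 `exists_hybridNE7_of_affinityDefectLetter_response_boundedCurrent` fed with §1]: (R‑c)
replaced by `|A' K s τ| ≤ M·A K s τ` (`0 ≤ M`); conclusion with radius `K ↦ l₀·(R₁ K + 2√(2η_K)·M)∕vol`. -/
theorem exists_hybridNE7_of_coverLetters_tameTilt_and_boundedCurrent (hl₀ : 0 ≤ l₀) (hvol : 0 < vol)
    (T : ℕ → Finset (Finset α)) (A B : ℕ → ℝ → Finset α → ℝ)
    (hA0 : ∀ K t, ∀ X ∈ T K, 0 ≤ A K t X) (hB0 : ∀ K t, ∀ X ∈ T K, 0 ≤ B K t X)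
    (hA : ∀ (K : ℕ) (t : ℝ), |t| ≤ l₀ → ∀ X ∈ T K, 0 < A K t X) (hB : ∀ (K : ℕ) (t : ℝ), |t| ≤ l₀ → ∀ X ∈ T K, 0 < B K t X)
    (hZA : ∀ (K : ℕ) (t : ℝ), |t| ≤ l₀ → 0 < ∑ τ ∈ T K, A K t τ) (hZB : ∀ (K : ℕ) (t : ℝ), |t| ≤ l₀ → 0 < ∑ τ ∈ T K, B K t τ)
    {Z : ℕ → ℝ → ℝ} (hZA' : ∀ (K : ℕ) (t : ℝ), |t| ≤ l₀ → Z K t = ∑ τ ∈ T K, A K t τ)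
    (hZB' : ∀ (K : ℕ) (t : ℝ), |t| ≤ l₀ → Z (K + 1) t = ∑ τ ∈ T K, B K t τ)
    {A' B' : ℕ → ℝ → Finset α → ℝ}
    (hdA : ∀ (K : ℕ) (s : ℝ), |s| ≤ l₀ → ∀ τ ∈ T K, HasDerivAt (fun u => A K u τ) (A' K s τ) s)
    (hdB : ∀ (K : ℕ) (s : ℝ), |s| ≤ l₀ → ∀ τ ∈ T K, HasDerivAt (fun u => B K u τ) (B' K s τ) s)
    (hdown : ∀ K, ∀ X ∈ T K, ∀ Y, Y ⊆ X → Y ∈ T K)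
    (W : ℕ → ℝ → Finset (Finset α)) (hW : ∀ K t, W K t ⊆ T K)
    {θA ΛA ζA κA ZA : ℝ} (bA : ℝ) (hθA : 0 ≤ θA) (hΛθA : ΛA + ζA < θA) (hκA : 2 < κA * (θA - ΛA - ζA))
    (UA : ℕ → ℝ → ℕ → Finset α) (wA ℓA PA : ℕ → ℝ → ℕ → α → ℝ)
    (hwA0 : ∀ K t m j, 0 ≤ wA K t m j)
    (hwA : ∀ K t m, ∀ j ∈ UA K t m, wA K t m j ≤ Real.exp (-PA K t m j))
    (hθPA : ∀ K t m, ∀ j ∈ UA K t m, θA * ℓA K t m j ≤ PA K t m j / 2)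
    (hZ0A : ∀ K t (m : ℕ), ∑ j ∈ UA K t m, Real.exp (-(PA K t m j / 2)) ≤ ZA + ζA * m)
    (hfacA : ∀ K t m, ∀ X ∈ T K, ∀ S, S ⊆ X → A K t X ≤ (∏ j ∈ S, wA K t m j) * A K t (X \ S))
    (PosA : ℕ → ℕ → Finset πA) (hposA : ∀ K m, ((PosA K m).card : ℝ) ≤ Real.exp (ΛA * m))
    (OverA : ℕ → ℝ → ℕ → πA → Finset α → Prop) [∀ K t m p, DecidablePred (OverA K t m p)]
    (hpendA : ∀ K t m p, ∀ X ∈ T K, OverA K t m p X → ∃ S, S ⊆ UA K t m ∧ ((m : ℝ) - bA ≤ ∑ j ∈ S, ℓA K t m j) ∧ S ⊆ X)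
    (MA : ℕ → ℕ)
    (hcoverA : ∀ (K : ℕ) (t : ℝ), |t| ≤ l₀ → 1 ≤ K → ∀ X ∈ W K t,
      ∃ m ∈ range (MA K), bA + κA * Real.log (K : ℝ) ≤ (m : ℝ) ∧ ∃ p ∈ PosA K m, OverA K t m p X)
    {θB ΛB ζB κB ZB : ℝ} (bB : ℝ) (hθB : 0 ≤ θB) (hΛθB : ΛB + ζB < θB) (hκB : 2 < κB * (θB - ΛB - ζB))
    (UB : ℕ → ℝ → ℕ → Finset α) (wB ℓB PB : ℕ → ℝ → ℕ → α → ℝ)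
    (hwB0 : ∀ K t m j, 0 ≤ wB K t m j)
    (hwB : ∀ K t m, ∀ j ∈ UB K t m, wB K t m j ≤ Real.exp (-PB K t m j))
    (hθPB : ∀ K t m, ∀ j ∈ UB K t m, θB * ℓB K t m j ≤ PB K t m j / 2)
    (hZ0B : ∀ K t (m : ℕ), ∑ j ∈ UB K t m, Real.exp (-(PB K t m j / 2)) ≤ ZB + ζB * m)
    (hfacB : ∀ K t m, ∀ X ∈ T K, ∀ S, S ⊆ X → B K t X ≤ (∏ j ∈ S, wB K t m j) * B K t (X \ S))
    (PosB : ℕ → ℕ → Finset πB) (hposB : ∀ K m, ((PosB K m).card : ℝ) ≤ Real.exp (ΛB * m))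
    (OverB : ℕ → ℝ → ℕ → πB → Finset α → Prop) [∀ K t m p, DecidablePred (OverB K t m p)]
    (hpendB : ∀ K t m p, ∀ X ∈ T K, OverB K t m p X → ∃ S, S ⊆ UB K t m ∧ ((m : ℝ) - bB ≤ ∑ j ∈ S, ℓB K t m j) ∧ S ⊆ X)
    (MB : ℕ → ℕ)
    (hcoverB : ∀ (K : ℕ) (t : ℝ), |t| ≤ l₀ → 1 ≤ K → ∀ X ∈ W K t,
      ∃ m ∈ range (MB K), bB + κB * Real.log (K : ℝ) ≤ (m : ℝ) ∧ ∃ p ∈ PosB K m, OverB K t m p X)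
    (r : ℕ → ℝ) (hr : ∀ K, 0 < r K) (hrs : Summable fun K => 1 / r K)
    {𝔅 : ℝ} (h𝔅 : 0 ≤ 𝔅)
    (htilt : ∀ K t, |t| ≤ l₀ → ∃ φ : ℂ → ℂ,
      DifferentiableOn ℂ φ (Metric.closedBall 0 (r K)) ∧
      (∀ s ∈ Metric.closedBall (0:ℂ) (r K), Complex.exp (φ s)
        = (∑ τ ∈ T K \ W K t, (A K t τ : ℂ) * Complex.exp (s * ((Real.log (B K t τ) - Real.log (A K t τ) : ℝ) : ℂ)))
            / ∑ τ ∈ T K \ W K t, (A K t τ : ℂ)) ∧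
      (∀ s ∈ Metric.closedBall (0:ℂ) (r K), ‖φ s‖ ≤ 𝔅))
    {R₁ : ℕ → ℝ} {M : ℝ} (hM : 0 ≤ M)
    (hR : ∀ (K : ℕ) (s : ℝ), |s| ≤ l₀ →
      |∑ τ ∈ T K, B K s τ / (∑ σ ∈ T K, B K s σ) * (B' K s τ / B K s τ - A' K s τ / A K s τ)| ≤ R₁ K)
    (hRs : Summable R₁)
    (hcur : ∀ (K : ℕ) (s : ℝ), |s| ≤ l₀ → ∀ τ ∈ T K, |A' K s τ| ≤ M * A K s τ) :
    ∃ (η Wsh : ℕ → ℝ) (shA shB : ℕ → ℝ → Finset α → ℝ),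
      (∀ (K : ℕ) (t : ℝ), |t| ≤ l₀ →
        1 - ∑ τ ∈ T K, Real.sqrt ((A K t τ / ∑ σ ∈ T K, A K t σ) * (B K t τ / ∑ σ ∈ T K, B K t σ)) ≤ η K) ∧
      Summable (fun K => Real.sqrt (η K)) ∧
      (∀ K, 0 ≤ Wsh K ∧ Wsh K ≤ Real.sqrt (2 * η K) ∧ Wsh K < 1) ∧
      HybridNE7 l₀ vol T A B (fun _ _ => ∅) (fun _ => 0) shA shB Wsh
        (fun K => l₀ * (R₁ K + 2 * Real.sqrt (2 * η K) * M) / vol) :=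
  exists_hybridNE7_of_affinityDefectLetter_response_boundedCurrent hl₀ hvol hA hB hZA hZB hZA' hZB' hdA hdB
    (affinityDefectLetter_of_coverLetters_and_tameTilt T A B hA0 hB0 hA hB hdown W hW bA hθA hΛθA hκA UA wA ℓA PA hwA0 hwA hθPA hZ0A hfacA
      PosA hposA OverA hpendA MA hcoverA bB hθB hΛθB hκB UB wB ℓB PB hwB0 hwB hθPB hZ0B hfacB PosB hposB OverB hpendB MB hcoverB r hr hrs h𝔅 htilt)
    hM hR hRs hcur

end Capstone

end Summit.QuantumFields.YangMills.BalabanUVNodes.N20CoverLetterRoad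

end
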